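/-
VALUE = THEOREM, NOT summit progress (cell b2b-lgcu-borel, gen 25); crux 14079 untouched.
-/
import Mathlib
import Summits.MatrixMultiplication.MatrixMultiplication.Theorems.SubgroupIdentityDesigns.Negative.IrreducibleClassS

/-!
# Class-(S) members have scalar centraliser (absolute irreducibility)

VALUE = THEOREM (structure law for the members of HYPOTHETICAL level-one witnesses of the crux
`SubgroupIdentityDesigns`, `m = 3`, `k = 1`), NOT summit progress.  The crux item is neither
restated nor weakened; this file is a `--supports` helper under `Negative/`.

LINEAR ALGEBRA IN `𝔽_p³` (§1).  `eq_vecMulVec_of_mulVec_two`: a `3 × 3` matrix killing two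
independent vectors is an outer product `c ⊗ δ` (rank ≤ 1, landed
`exists_eq_vecMulVec_of_rank_le_one_gl`).  `vecMulVec_sq_eq_zero`: an outer product with vanishing
cube squares to `0` (a nilpotent `3 × 3` matrix cubes to `0`: landed `BorelConfinement.cube_eq_zero`).
`exists_eigenvector_of_commute`: a matrix `z` commuting with `N`, `N² ≠ 0 = N³`, has an
eigenvector (a kernel vector `v` of `N`; if `z v ∉ 𝔽_p v` then `ker N ⊇ ⟨v, z v⟩` is a plane, so
`N = c ⊗ δ` and `N² = 0`).

SCHUR-LITE (§2, `scalar_of_eigenvector`).  If `H ≤ GL₃(𝔽_p)` fixes no line and `z ∈ M₃(𝔽_p)`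
commutes with `H` and has an eigenvector `v`, `z v = a v`, then `z = a · 1`: `M = z − a` kills `v`
and `h₁ v ∉ 𝔽_p v`, so `M = c ⊗ δ`; if `M ≠ 0` the line `⟨c⟩ = Im M` is `H`-invariant — excluded.

MEMBER COROLLARY (§3, `classS_centraliser_scalar`; TPP + level-one design + crux inequality,
`p ≥ 3`, `−2 < ε ≤ 1`).  For a member `H` of a `(3,1)`-witness with a NON-NORMAL Sylow
`p`-subgroup (class (S) of `MemberTrichotomy.member_classification`), every matrix commuting with
`H` is scalar: `C_{M₃(𝔽_p)}(H) = 𝔽_p · 1`.  PROOF.  Class (S) supplies `u ∈ H` of order `p` with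
`N = u − 1`, `N² ≠ 0` (no quadratic unipotent), `N³ = 0` (`BorelConfinement.sub_one_pow_prime`,
`cube_eq_zero`); a commuting `z` has an eigenvector by
§1 and is scalar by §2 and `IrreducibleClassS.classS_member_irreducible` (no fixed line).  So a
class-(S) member is ABSOLUTELY IRREDUCIBLE (`End_{𝔽_p H}(𝔽_p³) = 𝔽_p`), its centre is
`H ∩ Z(GL₃)`, and `H ↦ H Z/Z ≤ PGL₃(p)` is the setting of Mitchell's theorem (successor menu S-15).

HONEST SCOPE.  No `(p, ε)` cell is emptied.  Sorry-free; standard axioms.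
-/

set_option linter.dupNamespace false

noncomputable section

open scoped BigOperators Classical Matrix

namespace Summit.MatrixMultiplication.MatrixMultiplication.Theorems.SubgroupIdentityDesigns.Negative
namespace CentraliserClassS

open Summit.MatrixMultiplication.MatrixMultiplication.Theorems.LieRankDesigns.Negative (GLm Mat budget)
open Literature.Barriers.MatrixMultiplication (SubgroupTPP)
open Matrix (vecMulVec)

variable {p : ℕ} [hp : Fact p.Prime]

/-! ## 1. Linear algebra in `𝔽_p³` -/

/-- A `3 × 3` matrix killing two independent vectors is an outer product `c ⊗ δ`. -/
theorem eq_vecMulVec_of_mulVec_two {M : Mat p 3} {v v' : Fin 3 → ZMod p} (hv : v ≠ 0)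
    (hind : ∀ a : ZMod p, a • v ≠ v') (h1 : M *ᵥ v = 0) (h2 : M *ᵥ v' = 0) :
    ∃ c δ : Fin 3 → ZMod p, M = vecMulVec c δ := by
  apply exists_eq_vecMulVec_of_rank_le_one_gl
  have hli : LinearIndependent (ZMod p) ![v, v'] := (LinearIndependent.pair_iff' hv).mpr hind
  have hv₁ : v ∈ LinearMap.ker M.mulVecLin := by
    rw [LinearMap.mem_ker, Matrix.mulVecLin_apply, h1]
  have hv₂ : v' ∈ LinearMap.ker M.mulVecLin := by
    rw [LinearMap.mem_ker, Matrix.mulVecLin_apply, h2]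
  have hli' : LinearIndependent (ZMod p)
      (![⟨v, hv₁⟩, ⟨v', hv₂⟩] : Fin 2 → LinearMap.ker M.mulVecLin) := by
    apply LinearIndependent.of_comp (LinearMap.ker M.mulVecLin).subtype
    have hfun : ⇑(LinearMap.ker M.mulVecLin).subtype ∘
        (![⟨v, hv₁⟩, ⟨v', hv₂⟩] : Fin 2 → LinearMap.ker M.mulVecLin) = ![v, v'] := by
      ext i j
      fin_cases i <;> rfl
    rw [hfun]
    exact hli
  have hk := hli'.fintype_card_le_finrank
  rw [Fintype.card_fin] at hk
  have h3 := LinearMap.finrank_range_add_finrank_ker M.mulVecLin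
  rw [Module.finrank_fin_fun] at h3
  unfold Matrix.rank
  omega

/-- An outer product with vanishing cube has vanishing square. -/
theorem vecMulVec_sq_eq_zero {c δ : Fin 3 → ZMod p} (h3 : vecMulVec c δ ^ 3 = (0 : Mat p 3)) :
    vecMulVec c δ * vecMulVec c δ = 0 := by
  have hsq : vecMulVec c δ * vecMulVec c δ = (δ ⬝ᵥ c) • vecMulVec c δ :=
    RootElements.vmv_mul_vmv c δ c δ
  have hcube : vecMulVec c δ ^ 3 = ((δ ⬝ᵥ c) * (δ ⬝ᵥ c)) • vecMulVec c δ := by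
    rw [pow_succ, pow_two, hsq, smul_mul_assoc, hsq, smul_smul]
  rw [hcube, smul_eq_zero, mul_self_eq_zero] at h3
  rcases h3 with h | h
  · rw [hsq, h, zero_smul]
  · rw [h, Matrix.mul_zero]

/-- `(c ⊗ δ) w = δ(w) c`. -/
theorem vmv_mulVec (c δ w : Fin 3 → ZMod p) : vecMulVec c δ *ᵥ w = (δ ⬝ᵥ w) • c := by
  ext i
  simp only [Matrix.mulVec, dotProduct, Matrix.vecMulVec_apply, Pi.smul_apply, smul_eq_mul]
  rw [Finset.sum_mul]
  exact Finset.sum_congr rfl fun j _ => by ring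

/-- A matrix commuting with `N`, `N² ≠ 0 = N³`, has an eigenvector in `𝔽_p³`. -/
theorem exists_eigenvector_of_commute {z N : Mat p 3} (hzN : z * N = N * z) (hN2 : N * N ≠ 0)
    (hN3 : N ^ 3 = 0) : ∃ v : Fin 3 → ZMod p, v ≠ 0 ∧ ∃ a : ZMod p, z *ᵥ v = a • v := by
  have hdet : N.det = 0 := by
    have h := congrArg Matrix.det hN3
    rw [Matrix.det_pow, Matrix.det_zero] at h
    exact (pow_eq_zero_iff three_ne_zero).mp h
  obtain ⟨v, hv, hNv⟩ := Matrix.exists_mulVec_eq_zero_iff.mpr hdet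
  by_cases hex : ∃ a : ZMod p, z *ᵥ v = a • v
  · exact ⟨v, hv, hex⟩
  push Not at hex
  exfalso
  have hNzv : N *ᵥ (z *ᵥ v) = 0 := by
    rw [Matrix.mulVec_mulVec, ← hzN, ← Matrix.mulVec_mulVec, hNv, Matrix.mulVec_zero]
  obtain ⟨c, δ, hcδ⟩ := eq_vecMulVec_of_mulVec_two hv (fun a h => hex a h.symm) hNv hNzv
  apply hN2
  rw [hcδ] at hN3 ⊢
  exact vecMulVec_sq_eq_zero hN3

/-! ## 2. Schur-lite -/

/-- **Schur-lite.**  `H ≤ GL₃(𝔽_p)` fixing no line, `z` commuting with `H` with an eigenvector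
`z v = a v`: then `z = a · 1`. -/
theorem scalar_of_eigenvector {H : Subgroup (GLm p 3)}
    (hline : ∀ v : Fin 3 → ZMod p, v ≠ 0 → ∃ h ∈ H, ∀ a : ZMod p, (h : Mat p 3) *ᵥ v ≠ a • v)
    {z : Mat p 3} (hz : ∀ h ∈ H, (h : Mat p 3) * z = z * (h : Mat p 3))
    {v : Fin 3 → ZMod p} (hv : v ≠ 0) {a : ZMod p} (hav : z *ᵥ v = a • v) :
    z = a • (1 : Mat p 3) := by
  set M : Mat p 3 := z - a • (1 : Mat p 3) with hM
  have hMh : ∀ h ∈ H, (h : Mat p 3) * M = M * (h : Mat p 3) := by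
    intro h hh
    rw [hM, Matrix.mul_sub, Matrix.sub_mul, hz h hh, Matrix.mul_smul, Matrix.smul_mul,
      Matrix.mul_one, Matrix.one_mul]
  have hMv : M *ᵥ v = 0 := by
    rw [hM, Matrix.sub_mulVec, hav, Matrix.smul_mulVec, Matrix.one_mulVec, sub_self]
  obtain ⟨h₁, hh₁, hne⟩ := hline v hv
  have hMv' : M *ᵥ ((h₁ : Mat p 3) *ᵥ v) = 0 := by
    rw [Matrix.mulVec_mulVec, ← hMh h₁ hh₁, ← Matrix.mulVec_mulVec, hMv, Matrix.mulVec_zero]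
  obtain ⟨c, δ, hcδ⟩ := eq_vecMulVec_of_mulVec_two hv (fun b hb => hne b hb.symm) hMv hMv'
  by_contra hza
  have hM0 : M ≠ 0 := fun h0 => hza (sub_eq_zero.mp h0)
  have hc : c ≠ 0 := by
    rintro rfl
    exact hM0 (by rw [hcδ, Matrix.zero_vecMulVec])
  have hδ : δ ≠ 0 := by
    rintro rfl
    exact hM0 (by rw [hcδ, Matrix.vecMulVec_zero])
  obtain ⟨j, hj⟩ : ∃ j, δ j ≠ 0 := by
    by_contra h
    push Not at h
    exact hδ (funext h)
  obtain ⟨h₂, hh₂, hne₂⟩ := hline c hc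
  have e1 : (h₂ : Mat p 3) *ᵥ (M *ᵥ Pi.single j 1) = M *ᵥ ((h₂ : Mat p 3) *ᵥ Pi.single j 1) := by
    rw [Matrix.mulVec_mulVec, Matrix.mulVec_mulVec, hMh h₂ hh₂]
  rw [hcδ, vmv_mulVec, vmv_mulVec, Matrix.mulVec_smul, dotProduct_single_one] at e1
  exact hne₂ ((δ j)⁻¹ * (δ ⬝ᵥ ((h₂ : Mat p 3) *ᵥ Pi.single j 1)))
    (by rw [mul_smul, ← e1, smul_smul, inv_mul_cancel₀ hj, one_smul])

/-! ## 3. Class (S): the centraliser is scalar -/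

/-- **Scalar centraliser for class (S).**  Under TPP + level-one design + crux inequality
(`p ≥ 3`, `−2 < ε ≤ 1`), for a member `H` with a non-normal Sylow `p`-subgroup every matrix
commuting with `H` is scalar. -/
theorem classS_centraliser_scalar (hp3 : 3 ≤ p) {ε : ℝ} (hε : -2 < ε) (hε1 : ε ≤ 1)
    {H₁ H₂ H₃ : Subgroup (GLm p 3)} (htpp : SubgroupTPP H₁ H₂ H₃)
    (hdes : ∃ cf : Mat p 3 → ℂ, (∀ M, 1 < M.rank → cf M = 0) ∧
      (∑ M, cf M * ZMod.stdAddChar (Matrix.trace (M * ((1 : GLm p 3) : Mat p 3)))) = 1 ∧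
      ∀ a ∈ H₁, ∀ b ∈ H₂, ∀ g ∈ H₃, a * b * g ≠ 1 →
        (∑ M, cf M * ZMod.stdAddChar
          (Matrix.trace (M * ((a * b * g : GLm p 3) : Mat p 3)))) = 0)
    (hlt : budget p 3 1 (2 + ε) <
      ((Nat.card H₁ * Nat.card H₂ * Nat.card H₃ : ℕ) : ℝ) ^ ((2 + ε) / 3))
    (H : Subgroup (GLm p 3)) (hH : H = H₁ ∨ H = H₂ ∨ H = H₃) (P : Sylow p H)
    (hP : ¬ (P : Subgroup H).Normal) {z : Mat p 3}
    (hz : ∀ h ∈ H, (h : Mat p 3) * z = z * (h : Mat p 3)) :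
    ∃ a : ZMod p, z = a • (1 : Mat p 3) := by
  obtain ⟨hline, -⟩ :=
    IrreducibleClassS.classS_member_irreducible hp3 hε hε1 htpp hdes hlt H hH P hP
  -- class (S): Sylow subgroups of order p, no quadratic unipotent
  have hS : (∀ Q : Sylow p H, ¬ (Q : Subgroup H).Normal ∧ Nat.card Q = p) ∧
      ∀ u ∈ H, ((u : Mat p 3) - 1) * ((u : Mat p 3) - 1) = 0 → u = 1 := by
    rcases MemberTrichotomy.member_classification hp3 hε hε1 htpp hdes hlt H hH with
      hZ | ⟨hN, -⟩ | hN | hS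
    · exfalso
      have hbot : (P : Subgroup H) = ⊥ := Subgroup.eq_bot_of_card_eq _ (hZ P)
      exact hP (by rw [hbot]; infer_instance)
    · exact absurd (hN P).1 hP
    · exact absurd (hN P).1 hP
    · exact hS
  -- an element u ∈ H of order p
  set T : Subgroup (GLm p 3) := (P : Subgroup H).map H.subtype with hTdef
  have hT : Nat.card T = p := by
    rw [hTdef, Subgroup.card_map_of_injective H.subtype_injective, (hS.1 P).2]
  have hTb : T ≠ ⊥ := (Subgroup.one_lt_card_iff_ne_bot _).mp (by rw [hT]; exact hp.out.one_lt)
  obtain ⟨⟨u, hu⟩, hu1⟩ := Subgroup.ne_bot_iff_exists_ne_one.mp hTb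
  have huH : u ∈ H := Subgroup.map_subtype_le _ hu
  have hu1' : u ≠ 1 := fun h => hu1 (Subtype.ext h)
  have hup : u ^ p = 1 := PlaneFreeClassS.pow_prime_eq_one_of_mem hT hu
  set N : Mat p 3 := (u : Mat p 3) - 1 with hN
  have hN3 : N ^ 3 = 0 := BorelConfinement.cube_eq_zero ⟨p, BorelConfinement.sub_one_pow_prime hup⟩
  have hN2 : N * N ≠ 0 := fun h => hu1' (hS.2 u huH h)
  have hzN : z * N = N * z := by
    rw [hN, Matrix.mul_sub, Matrix.sub_mul, Matrix.mul_one, Matrix.one_mul, hz u huH]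
  obtain ⟨v, hv, a, hav⟩ := exists_eigenvector_of_commute hzN hN2 hN3
  exact ⟨a, scalar_of_eigenvector hline hz hv hav⟩

/-- In particular the centre of a class-(S) member consists of scalar matrices. -/
theorem classS_centre_scalar (hp3 : 3 ≤ p) {ε : ℝ} (hε : -2 < ε) (hε1 : ε ≤ 1)
    {H₁ H₂ H₃ : Subgroup (GLm p 3)} (htpp : SubgroupTPP H₁ H₂ H₃)
    (hdes : ∃ cf : Mat p 3 → ℂ, (∀ M, 1 < M.rank → cf M = 0) ∧
      (∑ M, cf M * ZMod.stdAddChar (Matrix.trace (M * ((1 : GLm p 3) : Mat p 3)))) = 1 ∧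
      ∀ a ∈ H₁, ∀ b ∈ H₂, ∀ g ∈ H₃, a * b * g ≠ 1 →
        (∑ M, cf M * ZMod.stdAddChar
          (Matrix.trace (M * ((a * b * g : GLm p 3) : Mat p 3)))) = 0)
    (hlt : budget p 3 1 (2 + ε) <
      ((Nat.card H₁ * Nat.card H₂ * Nat.card H₃ : ℕ) : ℝ) ^ ((2 + ε) / 3))
    (H : Subgroup (GLm p 3)) (hH : H = H₁ ∨ H = H₂ ∨ H = H₃) (P : Sylow p H)
    (hP : ¬ (P : Subgroup H).Normal) {z : GLm p 3} (hzH : z ∈ (Subgroup.center H).map H.subtype) :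
    ∃ a : ZMod p, (z : Mat p 3) = a • (1 : Mat p 3) := by
  obtain ⟨⟨z', hz'H⟩, hz'c, rfl⟩ := Subgroup.mem_map.mp hzH
  refine classS_centraliser_scalar hp3 hε hε1 htpp hdes hlt H hH P hP fun h hh => ?_
  have hc := Subgroup.mem_center_iff.mp hz'c ⟨h, hh⟩
  have hc' : h * z' = z' * h := congrArg Subtype.val hc
  change (h : Mat p 3) * ((z' : GLm p 3) : Mat p 3) = ((z' : GLm p 3) : Mat p 3) * (h : Mat p 3)
  rw [← Units.val_mul, ← Units.val_mul, hc']

end CentraliserClassS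
end Summit.MatrixMultiplication.MatrixMultiplication.Theorems.SubgroupIdentityDesigns.Negative
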